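import Literature.NumberTheory.Automorphic.Liu2021.LocalNormClassFlip
import Literature.NumberTheory.Automorphic.AnisotropicUnitaryGroupCompactOfPlace
import Literature.NumberTheory.Automorphic.UnitaryGroupNonsplitPlace
import HarnessLib

/-!
# A finite place at which `d = δ²` is a non-square — in particular every place where a hermitian PLANE is anisotropic — is NON-SPLIT in the
# quadratic extension `E = F(δ)`: every place `w ∣ v` of `E` is fixed by the conjugation, and `U(J)(F_v)` is compact with no extra witness
(Cassels–Fröhlich (1967), Ch. II §10; Platonov–Rapinchuk (1994), §3.1 Thm. 3.1)

Topic `NumberTheory/Automorphic`; namespace `Literature.NumberTheory.Automorphic.UnitaryGroup`.  THEOREMS ONLY (kernel lane): no `def`, no named fact, no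
instance, no notation, no `sorry`.

WHY (cell hodgecm-mathlib, `N = 2` letters of the floor-0 engine: «`v ∈ S ⊇ T`», `T` = the ANISOTROPIC places of the hermitian plane, ★
`RemD5CompanionParity`; P5's bridge ★ `AnisotropicUnitaryGroupCompactOfPlace`; the quaternion dictionary ★ `Rogawski1990/UnitaryTwoVariableQuaternionDictionaryCM`):
the tree's compactness theorems at an anisotropic place — ★ `compactSpace_local_of_not_isIsotropic`, ★ `compactSpace_cmDatum_local_of_not_isIsotropic`,
★ `compactSpace_local_of_mem_ramifiedPlaces` — all take a NON-SPLIT WITNESS `(w : PlacesOver E v) (hw : c • w.1 = w.1)` as an input, and the tree proves only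
the converse directions (★ `not_isSquare_delta_sq_of_nonsplit`, ★ `LocalRing.isField_of_smul_eq`, ★ `exists_placesOver_smul_ne_of_not_isField`).  This file
supplies the missing direction and the witness-free corollaries:

* §1 `isField_localRing_of_not_isSquare` — if `d` is NOT a square in `F_v` then `E_v = E ⊗_F F_v = F_v ⊕ F_v δ` is a FIELD (the norm form
  `a² − d b²` is anisotropic, ★ `LemD1OfPlace.eq_zero_of_algebraNorm_eq_zero`, and `x⁻¹ = (c ⊗ 1)x · ι_v(N x)⁻¹`, ★ `toLocalRing_algebraNorm`);
  `not_isField_localRing_of_ne` — two distinct places `w ≠ w'` above `v` make `E_v = Π_{w ∣ v} E_w` a non-field (zero divisors `𝟙_w · 𝟙_{w'} = 0`;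
  with `w' = c • w` this is ★ `LemD1IndexedNonVacuityAtPlace.not_isField_localRing_of_split`, here without its Weil-representation imports);
  **`smul_placesOver_eq_of_not_isSquare`** — hence every `w ∣ v` is fixed by `c`.
* §2 the hermitian plane `J = diag(t₀, t₁) ⊗ 1` of ★ `LemD1BinaryIsotropyOfPlace`: **`smul_placesOver_eq_of_not_isIsotropic`** (an ANISOTROPIC place is non-split,
  via ★ `RemD5.not_isSquare_of_not_isIsotropic`), and the witness-free compactness **`compactSpace_local_of_not_isIsotropic'`** (`U(J)(F_v)` compact at every
  anisotropic place — ★ `compactSpace_local_of_not_isIsotropic` fed with the witness of §1) and its CM packaging **`compactSpace_cmDatum_local_of_not_isIsotropic'`**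
  (`(cmDatum L 2 H).Local v`).

## References
* J. W. S. Cassels, A. Fröhlich (eds.), *Algebraic Number Theory* (1967), Ch. II §10 (`L ⊗_K K_v = Π_{w ∣ v} L_w`; `w` unique iff `L ⊗ K_v` is a field)
  [CasselsFrohlichANT1967].
* V. Platonov, A. Rapinchuk, *Algebraic Groups and Number Theory* (1994), §3.1 Thm. 3.1 (anisotropic ⇔ compact over a local field) [PlatonovRapinchuk1994].
* O. T. O'Meara, *Introduction to Quadratic Forms* (1963), §63B [Omeara1963].
-/

set_option autoImplicit false

noncomputable section

open scoped Matrix MatrixGroups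
open NumberField IsDedekindDomain

namespace Literature.NumberTheory.Automorphic.UnitaryGroup

open Literature.NumberTheory.Automorphic.Liu2021

variable {F : Type} (E : Type) [Field F] [NumberField F] [Field E] [NumberField E] [Algebra F E]
  [Algebra.IsQuadraticExtension F E] (v : HeightOneSpectrum (𝓞 F)) (c : E ≃ₐ[F] E) {δ : E}

/-! ## §1 `d` a non-square in `F_v` ⇒ `E ⊗_F F_v` is a field ⇒ `v` is non-split -/

/-- **`E_v = E ⊗_F F_v` is a FIELD when `d = δ²` is not a square in `F_v`**: a non-zero `x = ι_v a + ι_v b δ` has non-zero norm `a² − d b²`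
(★ `LemD1OfPlace.eq_zero_of_algebraNorm_eq_zero`), and then `x · ((c ⊗ 1)x · ι_v(N x)⁻¹) = 1` (★ `toLocalRing_algebraNorm`: `ι_v(N x) = x · (c ⊗ 1)x`).
[cite: CasselsFrohlichANT1967, Ch. II §10] [cite: Omeara1963, §63B] -/
theorem isField_localRing_of_not_isSquare (hcδ : c δ = -δ) (hδ : δ ≠ 0) {d : F} (hd : δ * δ = algebraMap F E d)
    (hns : ¬ IsSquare (algebraMap F (v.adicCompletion F) d)) : IsField (LocalRing E v) := by
  obtain ⟨w₀⟩ := PlacesOver.nonempty E v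
  refine ⟨⟨0, 1, fun h => zero_ne_one (congrFun h w₀)⟩, mul_comm, fun {a} ha => ?_⟩
  have hN : Algebra.norm (v.adicCompletion F) a ≠ 0 := fun h =>
    ha (LemD1OfPlace.eq_zero_of_algebraNorm_eq_zero E v c hcδ hδ hd hns a h)
  refine ⟨conjLocal E c v a * toLocalRing E v (Algebra.norm (v.adicCompletion F) a)⁻¹, ?_⟩
  rw [← mul_assoc, ← toLocalRing_algebraNorm E v c hcδ hδ a, ← map_mul, mul_inv_cancel₀ hN, map_one]

omit [NumberField F] [Algebra.IsQuadraticExtension F E] in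
/-- **`E_v = Π_{w ∣ v} E_w` is NOT a field when there are two distinct places above `v`**: the indicator idempotents `𝟙_w`, `𝟙_{w'}` are
non-zero with product `0`.  (With `w' = c • w` this is ★ `LemD1IndexedNonVacuityAtPlace.not_isField_localRing_of_split`, whose module carries the
Weil-representation imports; this two-place form is import-light.) [cite: CasselsFrohlichANT1967, Ch. II §10] -/
theorem not_isField_localRing_of_ne (w w' : PlacesOver E v) (hne : w' ≠ w) : ¬ IsField (LocalRing E v) := by
  classical
  intro hF
  letI := hF.toField
  have h1 : (Pi.single w 1 : LocalRing E v) ≠ 0 := fun h => by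
    have := congrFun h w
    rw [Pi.single_eq_same, Pi.zero_apply] at this
    exact one_ne_zero this
  have h2 : (Pi.single w' 1 : LocalRing E v) ≠ 0 := fun h => by
    have := congrFun h w'
    rw [Pi.single_eq_same, Pi.zero_apply] at this
    exact one_ne_zero this
  have h12 : (Pi.single w 1 : LocalRing E v) * Pi.single w' 1 = 0 := by
    funext u
    rw [Pi.mul_apply, Pi.zero_apply]
    by_cases hu : u = w
    · subst hu
      rw [Pi.single_eq_of_ne hne.symm, mul_zero]
    · rw [Pi.single_eq_of_ne hu, zero_mul]
  exact mul_ne_zero h1 h2 h12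

omit [Algebra.IsQuadraticExtension F E] in
/-- If `E ⊗_F F_v` is a field, every place `w ∣ v` of `E` is fixed by `c` (else `w ≠ c • w` are two places above `v`). [cite: CasselsFrohlichANT1967, Ch. II §10] -/
private theorem smul_placesOver_eq_of_isField' (hF : IsField (LocalRing E v)) (w : PlacesOver E v) : c • w.1 = w.1 := by
  by_contra hw
  exact not_isField_localRing_of_ne E v w ⟨c • w.1, by rw [HeightOneSpectrum.under_algEquiv_smul]; exact w.2⟩
    (fun h => hw (congrArg Subtype.val h)) hF

/-- **A place where `d = δ²` is a non-square is NON-SPLIT**: every `w ∣ v` is fixed by the conjugation `c`. [cite: CasselsFrohlichANT1967, Ch. II §10] -/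
theorem smul_placesOver_eq_of_not_isSquare (hcδ : c δ = -δ) (hδ : δ ≠ 0) {d : F} (hd : δ * δ = algebraMap F E d)
    (hns : ¬ IsSquare (algebraMap F (v.adicCompletion F) d)) (w : PlacesOver E v) : c • w.1 = w.1 :=
  smul_placesOver_eq_of_isField' E v c (isField_localRing_of_not_isSquare E v c hcδ hδ hd hns) w

/-- … in `∃` form: there is a place `w ∣ v` fixed by `c` (★ `PlacesOver.nonempty`). [cite: CasselsFrohlichANT1967, Ch. II §10] -/
theorem exists_placesOver_smul_eq_of_not_isSquare (hcδ : c δ = -δ) (hδ : δ ≠ 0) {d : F} (hd : δ * δ = algebraMap F E d)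
    (hns : ¬ IsSquare (algebraMap F (v.adicCompletion F) d)) : ∃ w : PlacesOver E v, c • w.1 = w.1 := by
  obtain ⟨w⟩ := PlacesOver.nonempty E v
  exact ⟨w, smul_placesOver_eq_of_not_isSquare E v c hcδ hδ hd hns w⟩

/-! ## §2 Anisotropic places of a hermitian plane are non-split; witness-free compactness -/

/-- **An ANISOTROPIC place of the hermitian plane `diag(t₀, t₁) ⊗ 1` is NON-SPLIT** (there `d` is a non-square, ★ `RemD5.not_isSquare_of_not_isIsotropic`):
every `w ∣ v` is fixed by `c`. [cite: CasselsFrohlichANT1967, Ch. II §10] [cite: Omeara1963, §63B] -/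
theorem smul_placesOver_eq_of_not_isIsotropic (hcδ : c δ = -δ) (hδ : δ ≠ 0) (t : Fin 2 → F) {J : Matrix (Fin 2) (Fin 2) E}
    (hJ : J = (Matrix.diagonal t).map (algebraMap F E)) (hJh : (J.map c)ᵀ = J) (hJdet : J.det ≠ 0)
    {d : F} (hd : δ * δ = algebraMap F E d) (ht : ∀ i, t i ≠ 0)
    (hv : ¬ LemD1.IsIsotropic (LemD1OfPlace.standingData E v c 2 J hcδ hδ le_rfl hJh hJdet)) (w : PlacesOver E v) :
    c • w.1 = w.1 :=
  smul_placesOver_eq_of_not_isSquare E v c hcδ hδ hd (RemD5.not_isSquare_of_not_isIsotropic E v c hcδ hδ t hJ hJh hJdet hd ht hv) w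

/-- **`U(J)(F_v)` is COMPACT at every ANISOTROPIC place of the plane `J = diag(t₀, t₁) ⊗ 1` — no non-split witness needed** (★
`compactSpace_local_of_not_isIsotropic` with the witness of §1; `c ≠ 1` because `c δ = −δ ≠ 0`). [cite: PlatonovRapinchuk1994, §3.1 Thm. 3.1]
[cite: CasselsFrohlichANT1967, Ch. II §10] -/
theorem compactSpace_local_of_not_isIsotropic' (hcδ : c δ = -δ) (hδ : δ ≠ 0) (t : Fin 2 → F) {J : Matrix (Fin 2) (Fin 2) E}
    (hJ : J = (Matrix.diagonal t).map (algebraMap F E)) (hJh : (J.map c)ᵀ = J) (hJdet : J.det ≠ 0)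
    {d : F} (hd : δ * δ = algebraMap F E d) (ht : ∀ i, t i ≠ 0)
    (hv : ¬ LemD1.IsIsotropic (LemD1OfPlace.standingData E v c 2 J hcδ hδ le_rfl hJh hJdet)) :
    CompactSpace («local» E c 2 J v) := by
  have hc : c ≠ 1 := by
    rintro rfl
    rw [AlgEquiv.one_apply] at hcδ
    exact hδ (self_eq_neg.1 hcδ)
  obtain ⟨w⟩ := PlacesOver.nonempty E v
  exact compactSpace_local_of_not_isIsotropic c hc 2 J v w
    (smul_placesOver_eq_of_not_isIsotropic E v c hcδ hδ t hJ hJh hJdet hd ht hv w) hcδ hδ le_rfl hJh hJdet hv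

/-- **CM packaging, witness-free**: for a CM field `L` (`c` = complex conjugation), `δ̄ = −δ ≠ 0`, `δ² = d`, and the hermitian plane `H = diag(t₀, t₁) ⊗ 1`
(`tᵢ ∈ L⁺`, `tᵢ ≠ 0`): at every finite place `v` of `L⁺` at which the local standing plane is ANISOTROPIC, `(cmDatum L 2 H).Local v` is COMPACT.
[cite: PlatonovRapinchuk1994, §3.1 Thm. 3.1] [cite: CasselsFrohlichANT1967, Ch. II §10] -/
theorem compactSpace_cmDatum_local_of_not_isIsotropic' (L : Type) [Field L] [NumberField L] [IsCMField L]
    (t : Fin 2 → maximalRealSubfield L) {H : Matrix (Fin 2) (Fin 2) L} (hH : H = (Matrix.diagonal t).map (algebraMap (maximalRealSubfield L) L))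
    (hHh : (H.map (IsCMField.complexConj L))ᵀ = H) (hHdet : H.det ≠ 0) (ht : ∀ i, t i ≠ 0)
    {δ : L} (hcδ : IsCMField.complexConj L δ = -δ) (hδ : δ ≠ 0) {d : maximalRealSubfield L} (hd : δ * δ = algebraMap (maximalRealSubfield L) L d)
    (v : HeightOneSpectrum (𝓞 ↥(maximalRealSubfield L)))
    (hv : ¬ LemD1.IsIsotropic (LemD1OfPlace.standingData L v (IsCMField.complexConj L) 2 H hcδ hδ le_rfl hHh hHdet)) :
    CompactSpace ((cmDatum L 2 H).Local v) := by
  obtain ⟨w⟩ := PlacesOver.nonempty L v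
  exact compactSpace_cmDatum_local_of_not_isIsotropic L 2 H v w
    (smul_placesOver_eq_of_not_isIsotropic L v (IsCMField.complexConj L) hcδ hδ t hH hHh hHdet hd ht hv w) hcδ hδ le_rfl hHh hHdet hv

end Literature.NumberTheory.Automorphic.UnitaryGroup

end
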